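import Summits.CriticalPhenomena.SAWScalingLimit.Theses.SAWThetaPercolation

/-!
# `PinchFreeSLE6` forces non-null conditioning events (negative-lane helper)

Refuter note for crux `SAWThetaPercolation.PinchFreeSLE6` (stmt-CriticalPhenomena-17995).
The conditioning combinator of the crux, `cond μ S = (μ S)⁻¹ • μ.restrict S`, returns the ZERO measure
on a `μ`-null event, and a family of laws that is eventually zero along `𝓝[>] 0` has no `TendstoLaw`
limit under a probability law. Hence any proof of the crux must in particular prove a support theorem
for SLE₆: the ε-pinch-free, wall-free event `good ε D` has positive SLE₆-mass for ε frequently near `0⁺`.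
(Heuristically that mass is `exp (-Θ(1/ε))` — an extensive, un-renormalised constraint — which is the
refuter's large-deviation objection recorded as evidence on the ledger item: the conditioned laws should
collapse onto length-minimising chords rather than converge to SLE_{8/3}.)
-/

namespace Summit.CriticalPhenomena.SAWScalingLimit.Theorems.PinchFreeSLE6.Negative

open MeasureTheory Filter Topology
open Literature.Probability.RandomPlanarGeometry
open scoped BoundedContinuousFunction

/-- Conditioning on a null event with the crux's combinator gives the zero measure. [folklore] -/
theorem cond_null_eq_zero (μ : Measure (CurveClass ℂ)) (S : Set (CurveClass ℂ)) (h : μ S = 0) :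
    (μ S)⁻¹ • μ.restrict S = 0 := by
  rw [Measure.restrict_eq_zero.2 h, smul_zero]

/-- A family of laws on curve classes that is eventually zero along `𝓝[>] 0` does not converge in law
(`TendstoLaw`, identity random variable) to any random curve under a probability measure
(test function `f ≡ 1`). [folklore] -/
theorem not_tendstoLaw_of_eventually_eq_zero {Ω' : Type*} [MeasurableSpace Ω'] (P' : Measure Ω')
    [IsProbabilityMeasure P'] (Z : Ω' → CurveClass ℂ) (P : ℝ → Measure (CurveClass ℂ))
    (h : ∀ᶠ ε in 𝓝[>] (0:ℝ), P ε = 0) :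
    ¬ TendstoLaw (Ωδ := fun _ => CurveClass ℂ) (fun _ c => c) P Z P' := by
  intro hT
  have h1 := hT (BoundedContinuousFunction.const (CurveClass ℂ) (1:ℝ))
  have h0 : Tendsto (fun ε => ∫ c, (BoundedContinuousFunction.const (CurveClass ℂ) (1:ℝ))
      ((fun (_ : ℝ) (c : CurveClass ℂ) => c) ε c) ∂P ε) (𝓝[>] (0:ℝ)) (𝓝 0) := by
    refine Tendsto.congr' ?_ tendsto_const_nhds
    filter_upwards [h] with ε hε
    simp [hε]
  have := tendsto_nhds_unique h1 h0
  simp at this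

/-- **Hidden obligation of the crux.** If `PinchFreeSLE6` holds then, for every Dobrushin domain `D` and
every chordal SLE₆ law `μ` in `D`, the ε-pinch-free / wall-free conditioning event is `μ`-non-null for
ε frequently near `0⁺` (given that the pre-Wiener measure is a probability measure, the standing
`Fact` of the SLE prelude). [folklore] -/
theorem frequently_conditioningEvent_ne_zero
    [Fact Literature.Probability.Process.isProjectiveLimit_preWienerMeasure]
    (h : Summit.CriticalPhenomena.SAWScalingLimit.Theses.SAWThetaPercolation.PinchFreeSLE6)
    (D : DobrushinDomain) (μ : Measure (CurveClass ℂ)) (hμ : IsSLELaw 6 D μ) :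
    ∃ᶠ ε in 𝓝[>] (0:ℝ),
      μ {c | (∀ γ : Curve ℂ, CurveClass.mk γ = c → ∀ s t : unitInterval, s < t → γ s = γ t →
            Metric.diam (γ '' Set.Icc s t) < ε) ∧
          c.range ∩ frontier D.carrier ⊆ Metric.ball (D.pt 0) ε ∪ Metric.ball (D.pt 1) ε} ≠ 0 := by
  unfold Summit.CriticalPhenomena.SAWScalingLimit.Theses.SAWThetaPercolation.PinchFreeSLE6 at h
  dsimp only at h
  obtain ⟨Γ, -, -, hT⟩ := h D μ hμ
  by_contra hcon
  have hev := (Filter.not_frequently.1 hcon).mono fun ε hε => not_not.1 hε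
  refine not_tendstoLaw_of_eventually_eq_zero _ Γ _ ?_ hT
  filter_upwards [hev] with ε hε
  exact cond_null_eq_zero _ _ hε

end Summit.CriticalPhenomena.SAWScalingLimit.Theorems.PinchFreeSLE6.Negative
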